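import Summits.QuantumFields.YangMills.Theorems.IR.TelescopedCodingDefs
import HarnessLib

/-!
# Crux `IR` (stmt-QuantumFields-19354), line `telescoped-coding`: stub C2 (`stub_composeCoders`) — part 2, blocks and input balls

Helper module for item `stmt-QuantumFields-19354` (`--supports … --as helper`), second instalment of the composition stub C2 (vocabulary =
tree constants of `Theorems/IR/TelescopedCodingDefs.lean`): the deterministic geometry the composite coder needs.
* `cornerEdge M N q` — the first link of the `M`-block (of the seam-exact partition of `[0,N)⁴`) containing `q`; `reblock M N V q = V (cornerEdge q)`
  makes any configuration block-constant and FIXES block fields: `reblock_blockField : reblock M N (blockField M N U) = blockField M N U`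
  (so a coarse coder post-composed with `reblock` has the same law and is surely — not just a.s. — block-constant);
* `supDist` triangle inequality, monotonicity of `inputBall` in centre and radius;
* `exists_cornerLift`: the corner edge of a link in `inputBall N e R` is the reduction of a `ℤ⁴`-link within sup-distance `R + M` of `e` all of whose
  coordinates reduce mod `N` to multiples `Mκ < N` (a "corner lift");
* `cornerLift_inj`: two corner lifts in a common window with the same `M`-quantised positions and the same "first block of a period" bits
  coincide (`M ≤ N`) — the injection that bounds the number of blocks meeting an input ball UNIFORMLY IN `M` (`≤ (2R/M+3)⁴ · 2⁴` per direction).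

HONEST FRAMING: plumbing for ONE provable stub (C2) of ONE conditional line of the OPEN gap-crux `IR`; nothing here bears on the line's loads
or on the YM mass gap (Clay, NOT proved); `R4` closes only the conditional rung `BalabanLadder.UV`.
-/

set_option autoImplicit false

noncomputable section

open MeasureTheory Filter Function
open Literature.MathematicalPhysics.QuantumFieldTheory Literature.MathematicalPhysics.QuantumLattice

namespace Summit.QuantumFields.YangMills.Cruxes.IR.TelescopedCoding

/-! ## §1 Corner edges and the re-blockifier -/

section Blocks

variable {G : Type}

/-- The first link of the `M`-block containing `q` (same direction): coordinates `M ⌊x_l / M⌋` in the fundamental domain `[0, N)`. -/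
def cornerEdge (M N : ℕ) (q : Edge 4 N) : Edge 4 N :=
  (fun l => ((M * ((q.1 l).val / M) : ℕ) : ZMod N), q.2)

/-- **Re-blockifier**: copy to every link the value at the corner link of its `M`-block. -/
def reblock (M N : ℕ) (V : GaugeConfig 4 N G) : GaugeConfig 4 N G := fun q => V (cornerEdge M N q)

/-- `reblock` is measurable (pure re-indexing). -/
theorem measurable_reblock [MeasurableSpace G] (M N : ℕ) : Measurable (reblock (G := G) M N) :=
  measurable_pi_lambda _ fun _ => measurable_pi_apply _

/-- The coordinates of a corner edge. -/
theorem cornerEdge_val (M N : ℕ) [NeZero N] (q : Edge 4 N) (l : Fin 4) :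
    ((cornerEdge M N q).1 l).val = M * ((q.1 l).val / M) := by
  simp only [cornerEdge]
  rw [ZMod.val_natCast, Nat.mod_eq_of_lt]
  exact lt_of_le_of_lt (Nat.mul_div_le _ _) (ZMod.val_lt _)

/-- A corner edge lies in the same block. -/
theorem cornerEdge_div {M N : ℕ} [NeZero N] (hM : 0 < M) (q : Edge 4 N) (l : Fin 4) :
    ((cornerEdge M N q).1 l).val / M = (q.1 l).val / M := by
  rw [cornerEdge_val, Nat.mul_div_cancel_left _ hM]

/-- A corner edge has the same direction. -/
theorem cornerEdge_snd (M N : ℕ) (q : Edge 4 N) : (cornerEdge M N q).2 = q.2 := rfl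

/-- `cornerEdge` is idempotent. -/
theorem cornerEdge_cornerEdge {M N : ℕ} [NeZero N] (hM : 0 < M) (q : Edge 4 N) :
    cornerEdge M N (cornerEdge M N q) = cornerEdge M N q := by
  refine Prod.ext (funext fun l => ?_) rfl
  show ((M * (((cornerEdge M N q).1 l).val / M) : ℕ) : ZMod N) = ((M * ((q.1 l).val / M) : ℕ) : ZMod N)
  rw [cornerEdge_div hM]

/-- `reblock V` is block-constant: it factors through `cornerEdge`. -/
theorem reblock_apply (M N : ℕ) (V : GaugeConfig 4 N G) (q : Edge 4 N) : reblock M N V q = V (cornerEdge M N q) := rfl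

/-- **The re-blockifier fixes block fields** (the block-holonomy field is block-constant by construction). -/
theorem reblock_blockField [Group G] {M N : ℕ} [NeZero N] (hM : 0 < M) (U : GaugeConfig 4 N G) :
    reblock M N (blockField M N U) = blockField M N U := by
  funext q
  simp only [reblock, blockField, cornerEdge_div hM, cornerEdge_snd]

end Blocks

/-! ## §2 Sup-distance and input balls -/

section Balls

/-- `supDist x y ≤ R` coordinatewise. -/
theorem supDist_le_iff {x y : Fin 4 → ℤ} {R : ℕ} : supDist x y ≤ R ↔ ∀ i, (x i - y i).natAbs ≤ R := by
  unfold supDist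
  rw [Finset.sup_le_iff]
  exact ⟨fun h i => h i (Finset.mem_univ i), fun h i _ => h i⟩

/-- Triangle inequality for `supDist`. -/
theorem supDist_triangle (x y z : Fin 4 → ℤ) : supDist x z ≤ supDist x y + supDist y z := by
  rw [supDist_le_iff]
  intro i
  have h1 : (x i - y i).natAbs ≤ supDist x y := supDist_le_iff.1 le_rfl i
  have h2 : (y i - z i).natAbs ≤ supDist y z := supDist_le_iff.1 le_rfl i
  have h3 : (x i - z i).natAbs ≤ (x i - y i).natAbs + (y i - z i).natAbs := by
    have : x i - z i = (x i - y i) + (y i - z i) := by ring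
    rw [this]; exact Int.natAbs_add_le _ _
  omega

/-- `supDist` is symmetric. -/
theorem supDist_comm (x y : Fin 4 → ℤ) : supDist x y = supDist y x := by
  unfold supDist
  congr 1; funext i
  rw [← Int.natAbs_neg, neg_sub]

/-- Input balls grow with the radius and move with the centre. -/
theorem inputBall_subset {N : ℕ} {e e₁ : ZdEdge 4} {R₁ R₂ : ℕ} (h : supDist e₁.1 e.1 + R₁ ≤ R₂) :
    inputBall N e₁ R₁ ⊆ inputBall N e R₂ := by
  rintro x ⟨e', he', rfl⟩
  refine ⟨e', ?_, rfl⟩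
  have := supDist_triangle e'.1 e₁.1 e.1
  simp only [Set.mem_setOf_eq] at he' ⊢
  omega

/-- Input balls grow with the radius. -/
theorem inputBall_mono {N : ℕ} (e : ZdEdge 4) {R₁ R₂ : ℕ} (h : R₁ ≤ R₂) : inputBall N e R₁ ⊆ inputBall N e R₂ :=
  inputBall_subset (by rw [show supDist e.1 e.1 = 0 from by
    apply Nat.eq_zero_of_le_zero; rw [supDist_le_iff]; intro i; simp]; simpa using h)

end Balls

/-! ## §3 Corner lifts -/

section Lifts

/-- `e₁ : ℤ⁴`-link is a **corner lift** for block side `M` on the torus `N`: every coordinate reduces mod `N` to a multiple `Mκ < N`. -/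
def IsCornerLift (M N : ℕ) (e₁ : ZdEdge 4) : Prop :=
  ∀ l : Fin 4, ∃ κ : ℕ, M * κ < N ∧ e₁.1 l % (N : ℤ) = ((M * κ : ℕ) : ℤ)

/-- **Corner lift of a link in an input ball**: the corner edge of `x ∈ inputBall N e R` is the reduction of a corner lift within sup-distance
`R + M` of `e`. -/
theorem exists_cornerLift {M N : ℕ} [NeZero N] (hM : 0 < M) {e : ZdEdge 4} {R : ℕ} {x : Edge 4 N}
    (hx : x ∈ inputBall N e R) :
    ∃ e₁ : ZdEdge 4, torusEdge N e₁ = cornerEdge M N x ∧ supDist e₁.1 e.1 ≤ R + M ∧ IsCornerLift M N e₁ := by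
  obtain ⟨e', he', rfl⟩ := hx
  simp only [Set.mem_setOf_eq] at he'
  -- residues, block indices, offsets
  obtain ⟨v, hv⟩ : ∃ v : Fin 4 → ℕ, v = fun l => (((torusEdge N e').1 l)).val := ⟨_, rfl⟩
  have hvN : ∀ l, v l < N := fun l => by rw [hv]; exact ZMod.val_lt _
  have hdm : ∀ l, M * (v l / M) + v l % M = v l := fun l => Nat.div_add_mod (v l) M
  refine ⟨(fun l => e'.1 l - ((v l % M : ℕ) : ℤ), e'.2), ?_, ?_, ?_⟩
  · -- reduction mod N is the corner edge
    refine Prod.ext (funext fun l => ?_) rfl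
    show (((e'.1 l - ((v l % M : ℕ) : ℤ) : ℤ)) : ZMod N) = ((M * (((torusEdge N e').1 l).val / M) : ℕ) : ZMod N)
    have h1 : (((e'.1 l : ℤ)) : ZMod N) = ((v l : ℕ) : ZMod N) := by
      rw [hv]; simp only
      rw [ZMod.natCast_zmod_val]; rfl
    have h2 : ((torusEdge N e').1 l).val = v l := by rw [hv]
    rw [h2, Int.cast_sub, Int.cast_natCast, h1, ← Nat.cast_sub (Nat.mod_le _ _),
      Nat.sub_eq_of_eq_add (hdm l).symm]
  · -- distance
    rw [supDist_le_iff]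
    intro l
    have h1 : (e'.1 l - e.1 l).natAbs ≤ R := supDist_le_iff.1 he' l
    have h2 : v l % M < M := Nat.mod_lt _ hM
    have h3 : (e'.1 l - ((v l % M : ℕ) : ℤ) - e.1 l) = (e'.1 l - e.1 l) - ((v l % M : ℕ) : ℤ) := by ring
    show (e'.1 l - ((v l % M : ℕ) : ℤ) - e.1 l).natAbs ≤ R + M
    rw [h3]
    have h4 := Int.natAbs_sub_le (e'.1 l - e.1 l) ((v l % M : ℕ) : ℤ)
    rw [Int.natAbs_natCast] at h4
    omega
  · -- corner-lift structure
    intro l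
    refine ⟨v l / M, lt_of_le_of_lt (Nat.mul_div_le _ _) (hvN l), ?_⟩
    have h1 : (((e'.1 l - ((v l % M : ℕ) : ℤ) : ℤ)) : ZMod N) = (((M * (v l / M) : ℕ) : ℤ) : ZMod N) := by
      have h0 : (((e'.1 l : ℤ)) : ZMod N) = ((v l : ℕ) : ZMod N) := by
        rw [hv]; simp only
        rw [ZMod.natCast_zmod_val]; rfl
      rw [Int.cast_sub, Int.cast_natCast, h0, Int.cast_natCast, ← Nat.cast_sub (Nat.mod_le _ _),
        Nat.sub_eq_of_eq_add (hdm l).symm]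
    have h2 := (ZMod.intCast_eq_intCast_iff _ _ _).1 h1
    show (e'.1 l - ((v l % M : ℕ) : ℤ)) % (N : ℤ) = ((M * (v l / M) : ℕ) : ℤ)
    rw [h2]
    exact Int.emod_eq_of_lt (by positivity) (by exact_mod_cast lt_of_le_of_lt (Nat.mul_div_le _ _) (hvN l))

/-- The direction of a lift. -/
theorem torusEdge_snd (N : ℕ) (e₁ : ZdEdge 4) : (torusEdge N e₁).2 = e₁.2 := rfl

/-- **One-dimensional injectivity**: two corner-lift coordinates `t ≤ t'` in a window `[A, ∞)` with the same `M`-quantised position and the same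
"multiple of `N`" bit coincide (`0 < M ≤ N`). -/
theorem cornerLift_coord_eq_of_le {M N : ℕ} (hM : 0 < M) (hMN : M ≤ N) {A t t' : ℤ} (hA : A ≤ t) (htt' : t ≤ t')
    {κ κ' : ℕ} (hκ : M * κ < N) (hκ' : M * κ' < N)
    (hmod : t % (N : ℤ) = ((M * κ : ℕ) : ℤ)) (hmod' : t' % (N : ℤ) = ((M * κ' : ℕ) : ℤ))
    (hidx : (t - A).toNat / M = (t' - A).toNat / M) (hbit : (t % (N : ℤ) = 0 ↔ t' % (N : ℤ) = 0)) : t = t' := by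
  have hN0 : (0 : ℤ) < N := by exact_mod_cast lt_of_lt_of_le hM hMN
  have hMz : (0 : ℤ) < M := by exact_mod_cast hM
  -- the two points are `< M` apart
  have hlt : t' - t < M := by
    have ha : ((t - A).toNat : ℤ) = t - A := Int.toNat_of_nonneg (by linarith)
    have ha' : ((t' - A).toNat : ℤ) = t' - A := Int.toNat_of_nonneg (by linarith)
    have h1 : (t' - A).toNat < M * ((t' - A).toNat / M + 1) := Nat.lt_mul_div_succ _ hM
    have h2 : M * ((t - A).toNat / M) ≤ (t - A).toNat := Nat.mul_div_le _ _
    rw [hidx] at h2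
    have h3 : ((t' - A).toNat : ℤ) < ((t - A).toNat : ℤ) + M := by
      have : (t' - A).toNat < (t - A).toNat + M := by
        have := Nat.mul_succ M ((t' - A).toNat / M); rw [Nat.succ_eq_add_one] at this; omega
      exact_mod_cast this
    linarith
  -- Euclidean decompositions
  have ht : t = N * (t / N) + ((M * κ : ℕ) : ℤ) := by have := Int.emod_add_mul_ediv t N; rw [hmod] at this; linarith
  have ht' : t' = N * (t' / N) + ((M * κ' : ℕ) : ℤ) := by have := Int.emod_add_mul_ediv t' N; rw [hmod'] at this; linarith
  have hκN : ((M * κ : ℕ) : ℤ) < N := by exact_mod_cast hκ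
  have hκN' : ((M * κ' : ℕ) : ℤ) < N := by exact_mod_cast hκ'
  have hκ0 : (0 : ℤ) ≤ ((M * κ : ℕ) : ℤ) := by positivity
  have hκ0' : (0 : ℤ) ≤ ((M * κ' : ℕ) : ℤ) := by positivity
  rcases lt_trichotomy (t / N) (t' / N) with hd | hd | hd
  · -- later period: then `κ' = 0`, hence `κ = 0`, hence the gap is a positive multiple of `N ≥ M`
    exfalso
    have hd1 : t / N + 1 ≤ t' / N := hd
    have h1 : N * (t / N) + N ≤ N * (t' / N) := by nlinarith
    have h2 : ((M * κ' : ℕ) : ℤ) < M := by linarith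
    have hk' : κ' = 0 := by
      have h21 : M * κ' < M * 1 := by rw [mul_one]; exact_mod_cast h2
      have := Nat.lt_of_mul_lt_mul_left h21
      omega
    have h3 : t' % (N : ℤ) = 0 := by rw [hmod', hk']; simp
    have h4 : t % (N : ℤ) = 0 := hbit.2 h3
    have hk : ((M * κ : ℕ) : ℤ) = 0 := by rw [← hmod, h4]
    have h5 : (N : ℤ) ≤ t' - t := by
      rw [hk'] at ht'; rw [ht, ht', hk]; push_cast; nlinarith
    have h6 : (M : ℤ) ≤ N := by exact_mod_cast hMN
    linarith
  · -- same period: the gap is a multiple of `M` below `M`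
    rw [ht, ht', hd]
    congr 1
    have h1 : ((M * κ' : ℕ) : ℤ) - ((M * κ : ℕ) : ℤ) < M := by
      have : t' - t = ((M * κ' : ℕ) : ℤ) - ((M * κ : ℕ) : ℤ) := by rw [ht, ht', hd]; ring
      linarith
    have h2 : 0 ≤ ((M * κ' : ℕ) : ℤ) - ((M * κ : ℕ) : ℤ) := by
      have : t' - t = ((M * κ' : ℕ) : ℤ) - ((M * κ : ℕ) : ℤ) := by rw [ht, ht', hd]; ring
      linarith
    have h3 : κ ≤ κ' := by
      by_contra hc
      have : M * κ' < M * κ := Nat.mul_lt_mul_of_pos_left (lt_of_not_ge hc) hM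
      have : ((M * κ' : ℕ) : ℤ) < ((M * κ : ℕ) : ℤ) := by exact_mod_cast this
      linarith
    have h4 : κ' ≤ κ := by
      by_contra hc
      have hc' : κ + 1 ≤ κ' := lt_of_not_ge hc
      have : M * (κ + 1) ≤ M * κ' := Nat.mul_le_mul_left _ hc'
      have : ((M * (κ + 1) : ℕ) : ℤ) ≤ ((M * κ' : ℕ) : ℤ) := by exact_mod_cast this
      push_cast at this h1
      nlinarith
    have : κ = κ' := le_antisymm h3 h4
    rw [this]
  · -- earlier period contradicts `t ≤ t'`
    exfalso
    have hd1 : t' / N + 1 ≤ t / N := hd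
    have h1 : N * (t' / N) + N ≤ N * (t / N) := by nlinarith
    linarith

/-- Symmetric form of `cornerLift_coord_eq_of_le`. -/
theorem cornerLift_coord_eq {M N : ℕ} (hM : 0 < M) (hMN : M ≤ N) {A t t' : ℤ} (hA : A ≤ t) (hA' : A ≤ t')
    {κ κ' : ℕ} (hκ : M * κ < N) (hκ' : M * κ' < N)
    (hmod : t % (N : ℤ) = ((M * κ : ℕ) : ℤ)) (hmod' : t' % (N : ℤ) = ((M * κ' : ℕ) : ℤ))
    (hidx : (t - A).toNat / M = (t' - A).toNat / M) (hbit : (t % (N : ℤ) = 0 ↔ t' % (N : ℤ) = 0)) : t = t' := by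
  rcases le_total t t' with h | h
  · exact cornerLift_coord_eq_of_le hM hMN hA h hκ hκ' hmod hmod' hidx hbit
  · exact (cornerLift_coord_eq_of_le hM hMN hA' h hκ' hκ hmod' hmod hidx.symm hbit.symm).symm

end Lifts

end Summit.QuantumFields.YangMills.Cruxes.IR.TelescopedCoding

end
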